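import Literature.MathematicalPhysics.QuantumFieldTheory.Balaban1983to89.B6Eq2129TwoScaleV1
import Literature.MathematicalPhysics.QuantumFieldTheory.Balaban1983to89.B6Eq2146TwoScale

/-!
# `Balaban1983to89.B6Eq2143TwoScaleV1` — T. Bałaban, *Propagators and renormalization transformations for lattice gauge
# theories. II*, Commun. Math. Phys. **96** (1984) 223–250 [Balaban1984PropagatorsII], p. 248 before (2.143): *"The operator QGQ* is
# positive, hence the inverse is well defined and positive also"* — FOR THE CONCRETE TWO-SCALE LATTICE OPERATORS of the V1
# multi-level torus calculus: `Q = Q″Q_j` is onto `L²(𝔅)`, `Q*` is injective, `QGQ*` is positive definite and invertible, and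
# `(QGQ*)⁻¹` (the `C_□` of (2.143), one box) is positive

statement-level skeleton of published theorems with citation tags; proofs where landed; nothing here is a claim about the Yang–Mills mass gap

PDF held: `paper:balaban1984-cmp96-propagators-rt-ii` (journal page = PDF page + 222); p. 248 read AS IMAGE on the ×2 render
`run/shared/lean/pub/pub-balaban/b2b-balaban-ref1/pages/1984-cmp96-propagators-rt-II/…-p026-x2.png` (2026-08-21).
CITATION HEADER (lean-in-tree rule).  WHAT IS REPRODUCED: lit-balaban SKELETON rows **B6.Eq2.143 / B6.Eq2.144** (p. 248: positivity and
invertibility of `QGQ*`, the one-box operator `C_□ = ((QG_□Q*)↾_□)⁻¹` of (2.143)) as a MODEL INSTANCE on the concrete data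
`…B6SectCTwoScaleV1Lattice.tsV1` (same seat): `Q = Q″Q_j` is ONTO (from p21's multi-scale `…B6SectAVectorModelV1.QE_surjective` for the
two-scale family through this seat's bijection `…B6Eq2129TwoScaleV1.toBondIdx`), hence `Q*` is injective and `⟨Q*B, GQ*B⟩ > 0` for
`B ≠ 0` (`…B6Eq2146TwoScale.QGQs_pos`: `G = Δ_a⁻¹ > 0`), so `QGQ*` is a unit and its inverse is positive
(`…B6CovarianceOperator.isUnit_of_posDef`/`inverse_pos`).  PHASE-2 seat p22 (gen 8); owner r03, referee ref-4.  Nothing is restated.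

PRINT (p. 248, verbatim).  *"Finally let us consider the operator QGQ* and its inverse. We consider these operators on the L²-space
defined by (2.69) with sites replaced by bonds. The operator QGQ* is positive, hence the inverse is well defined and positive also.
… we consider the operators C_□ = ((QG_□Q*)↾_□)⁻¹, C = Σ_{□∈𝒟} h_□C_□h_□. (2.143)"*.

CONTENTS (0 sorry; standard axioms; `D := tsV1 hc Λ′ w`, hypotheses `c ≠ 0`, `j + 1 ≤ m + K`, `w > 0`): `Q_surjective_V1` (`Q = Q″Q_j` onto
`L²(𝔅)`, `𝔅 = Λ^c ∪ Λ′`), `Qs_injective_V1`, `QGQs` (the operator `QGQ*`), `QGQs_symm`, **`QGQs_posDef_V1`** (`⟨B, QGQ*B⟩ > 0` for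
`B ≠ 0`), **`isUnit_QGQs_V1`** (*"the inverse is well defined"*), **`inverse_QGQs_pos_V1`** (*"and positive also"*), `inverse_QGQs_symm_V1`.  HONEST SCOPE: one box
(the whole torus of the model plays `□`; the restriction `↾_□` and the partition `Σ h_□C_□h_□` of (2.143) are the business of
`…B6Eq291Generator`/`…B6Sect5Torus`); no bounds ((2.147) is gen 3's `…B6Eq2144.ineq2147_printed` under displayed hypotheses); NOT
summit progress.  Unit `lit-balaban-p22` (gen 8), HOME `run/shared/lean/pub/lit-balaban/`, 2026-08-21.
-/

noncomputable section

open scoped InnerProductSpace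

namespace Literature.MathematicalPhysics.QuantumFieldTheory.Balaban1983to89.B6Eq2143TwoScaleV1

open B6CovarianceOperator B6SectAOperatorsV1 B6SectAVectorModelV1 B6SectCOperators B6SectCOperators.TwoScaleData
  B6SectCTwoScaleV1 B6SectCTwoScaleV1Lattice B6Eq2129TwoScaleV1
open BalabanImbrieJaffe1984to88.BIJ85AxialPropagator411 (BondSpace)

variable {P : Params} {c : ℝ} (hc : c ≠ 0) {j : ℕ} (hj : j + 1 ≤ P.m + P.K) (Λ' : Finset (Site P (j + 1)))
  {w : CIdx j Λ' → ℝ} (hw : ∀ i, 0 < w i)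

include hj in
/-- **`Q = Q″Q_j` is onto `L²(𝔅)`** for the concrete two-scale data (p21's multi-scale `Q` of the family `twoScale j hj Λ′` is onto, and
`𝔅 = Λ^c ∪ Λ′` reindexes it). [cite: Balaban1984PropagatorsII, (2.119) p.243 + (2.144) p.248] -/
theorem Q_surjective_V1 : Function.Surjective (tsV1 hc Λ' w).Q := by
  intro t
  set e := Equiv.ofBijective (toBondIdx hj Λ') (toBondIdx_bijective hj Λ') with he
  obtain ⟨v, hv⟩ := QE_surjective (twoScale j hj Λ') (WithLp.toLp 2 fun p => t (e.symm p))
  refine ⟨v, PiLp.ext fun i => ?_⟩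
  have h1 : (tsV1 hc Λ' w).Q v i = QE (twoScale j hj Λ') v (toBondIdx hj Λ' i) := (QE_toBondIdx hj Λ' v i).symm
  rw [h1, hv, WithLp.ofLp_toLp]
  exact congrArg t (e.symm_apply_apply i)

include hj in
/-- hence **`Q*` is injective**. [cite: Balaban1984PropagatorsII, (2.144) p.248] -/
theorem Qs_injective_V1 : Function.Injective (LinearMap.adjoint (tsV1 hc Λ' w).Q) :=
  (injective_iff_map_eq_zero _).mpr fun x hx => by
    obtain ⟨v, hv⟩ := Q_surjective_V1 hc hj Λ' (w := w) x
    have h : ⟪x, x⟫_ℝ = 0 := by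
      calc ⟪x, x⟫_ℝ = ⟪x, (tsV1 hc Λ' w).Q v⟫_ℝ := by rw [hv]
        _ = ⟪LinearMap.adjoint (tsV1 hc Λ' w).Q x, v⟫_ℝ := (LinearMap.adjoint_inner_left _ _ _).symm
        _ = 0 := by rw [hx, inner_zero_left]
    exact inner_self_eq_zero.mp h

/-- the operator `QGQ*` on `L²(𝔅)` (`G = Δ_a⁻¹`). [cite: Balaban1984PropagatorsII, (2.143) p.248] -/
abbrev QGQs : CSpace j Λ' →ₗ[ℝ] CSpace j Λ' := (tsV1 hc Λ' w).Q ∘ₗ (tsV1 hc Λ' w).G ∘ₗ LinearMap.adjoint (tsV1 hc Λ' w).Q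

include hj hw in
/-- `QGQ*` is symmetric. [cite: Balaban1984PropagatorsII, (2.143) p.248] -/
theorem QGQs_symm (x y : CSpace j Λ') : ⟪QGQs hc Λ' (w := w) x, y⟫_ℝ = ⟪x, QGQs hc Λ' (w := w) y⟫_ℝ := by
  simp only [LinearMap.comp_apply]
  rw [← LinearMap.adjoint_inner_right (tsV1 hc Λ' w).Q ((tsV1 hc Λ' w).G (LinearMap.adjoint (tsV1 hc Λ' w).Q x)) y,
    ← LinearMap.adjoint_inner_left (tsV1 hc Λ' w).Q ((tsV1 hc Λ' w).G (LinearMap.adjoint (tsV1 hc Λ' w).Q y)) x,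
    B6SectCPositivity.G_symm (isLattice Λ' hc hj hw) (positive Λ' hc hj w)]

include hj hw in
/-- **p. 248 *"The operator QGQ* is positive"*** — positive DEFINITE for the concrete two-scale operators: `⟨B, QGQ*B⟩ > 0` for `B ≠ 0`
(`G = Δ_a⁻¹ > 0` and `Q*` injective). [cite: Balaban1984PropagatorsII, (2.143) p.248] -/
theorem QGQs_posDef_V1 (x : CSpace j Λ') (hx : x ≠ 0) : 0 < ⟪x, QGQs hc Λ' (w := w) x⟫_ℝ := by
  have hx' : LinearMap.adjoint (tsV1 hc Λ' w).Q x ≠ 0 := fun h => hx (Qs_injective_V1 hc hj Λ' (w := w) (by rw [h, map_zero]))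
  simp only [LinearMap.comp_apply]
  rw [← LinearMap.adjoint_inner_left]
  exact B6Eq2146TwoScale.QGQs_pos (isLattice Λ' hc hj hw) (positive Λ' hc hj w) x hx'

include hj hw in
/-- *"hence the inverse is well defined"*: `QGQ*` is a unit. [cite: Balaban1984PropagatorsII, (2.143) p.248] -/
theorem isUnit_QGQs_V1 : IsUnit (QGQs hc Λ' (w := w)) :=
  isUnit_of_posDef _ (QGQs_posDef_V1 hc hj Λ' hw)

include hj hw in
/-- *"and positive also"*: `(QGQ*)⁻¹` (the one-box `C_□` of (2.143)) is positive definite. [cite: Balaban1984PropagatorsII, (2.143) p.248] -/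
theorem inverse_QGQs_pos_V1 (x : CSpace j Λ') (hx : x ≠ 0) : 0 < ⟪x, Ring.inverse (QGQs hc Λ' (w := w)) x⟫_ℝ :=
  inverse_pos _ (QGQs_posDef_V1 hc hj Λ' hw) x hx

include hj hw in
/-- `(QGQ*)⁻¹` is symmetric. [cite: Balaban1984PropagatorsII, (2.143) p.248] -/
theorem inverse_QGQs_symm_V1 (x y : CSpace j Λ') :
    ⟪Ring.inverse (QGQs hc Λ' (w := w)) x, y⟫_ℝ = ⟪x, Ring.inverse (QGQs hc Λ' (w := w)) y⟫_ℝ :=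
  inverse_symm _ (QGQs_symm hc hj Λ' hw) (QGQs_posDef_V1 hc hj Λ' hw) x y

end Literature.MathematicalPhysics.QuantumFieldTheory.Balaban1983to89.B6Eq2143TwoScaleV1

end
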